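import Summits.AtomisticToContinuum.HydrodynamicLimit.Theorems.AntiMazurCoboundariesCorrectorPressureDecayTangentBiasTorus
import Summits.AtomisticToContinuum.HydrodynamicLimit.Theorems.AntiMazurCoboundariesCorrectorPressureDecayTangentBiasCutoff
import Summits.AtomisticToContinuum.HydrodynamicLimit.Theorems.AntiMazurCoboundariesCorrectorPressureDecayTangentBiasVelocityTail
import Summits.AtomisticToContinuum.HydrodynamicLimit.Theorems.AntiMazurCoboundariesCorrectorPressureDecayTangentBiasWindow

/-!
# Bias continuity along tangent states, V: `TangentBias` from the one-body limit and the Campbell bound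

File 5/5 of crux stmt-AtomisticToContinuum-14135 `AntiMazurCoboundaries.CorrectorPressureDecay`, line `FirstLemma`
(idea `kifer-compactification`), registered stub `stub_tangentBias : TangentBias` (`…KiferTangent.lean`); namespace
`…Theorems.KiferCompactification` (wave-2 stub-worker B of lead a1, assembled by the lead). Along a tangent state `μ`
of a tangent family the normalised one-body bias `(∫φ)⁻¹ σ³ (N+1)⁻¹ E_Q[Σᵢ φ(qᵢ) g((vᵢ − u₀)/√θ)]` converges to
`E_μ[Σ_{p ∈ ω, p.1 ∈ [0,1)³} g((p.2 − u₀)/√θ)]`, GIVEN the two remaining `N = ∞` facts of point-process theory in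
this concrete frame, taken as HYPOTHESES (registered stubs `stub_oneBodyLimit`, `stub_campbellBound` of the line):

* ONE-BODY LIMIT (`h₁`): along a tangent state, for every `h ∈ C_c(ℝ³ × ℝ³)` the linear statistic `ω ↦ Σ_{p∈ω} h(p)`
  is `μ`-integrable and `(∫φ)⁻¹ ∫ φ(x) E_{Q(ι k)}[Σᵢ h(blowUpPoint ε x zᵢ)] dx → E_μ[Σ_{p∈ω} h(p)]` (Laplace-functional
  convergence on `C_K⁺` + the hard-core a.s. bound + Weierstrass; Kallenberg Thm 16.16 in this frame);
* CAMPBELL BOUND (`h₂`): if moreover the laws put normalised mass `≤ δ` on velocities of norm `> R`, then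
  `E_μ[#{p ∈ ω : p.1 ∈ S, R < ‖p.2‖}] ≤ (∫φ)⁻¹ σ³ δ · vol(S)` for measurable `S` (from the one-body limit for
  `C_c⁺` minorants, the finite-`N` Campbell bound `integral_comp_blowUp_le`, monotone convergence, outer regularity).

ASSEMBLY `stub_tangentBiasOfFacts : h₁ → h₂ → TangentBias`: truncate velocities at a radius `R` carrying normalised
mass `≤ δ₁` under all `Q_k` (`velocityTail_of_isTangentFamily`, entropy), replace `1_{[0,1)³}` by a continuous `ψ`
equal to `1` off a shell of volume `≤ 6δ₀` (`exists_position_cutoff`), pass to the limit in the `C_c` statistic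
`h = ψ ⊗ χ g̃` (`h₁`, `tendsto_oneBody_sub`), and bound the four error terms by `2 (∫φ)⁻¹σ³κ (6δ₀ + δ₁) + o(1)`
(`abs_integral_oneBody_sub_cutoff_le`, `windowSum_approx`, `h₂`).
-/


noncomputable section

open MeasureTheory ProbabilityTheory Set Filter Topology
open scoped ENNReal

namespace Summit.AtomisticToContinuum.HydrodynamicLimit.Theorems.KiferCompactification

open Literature.MathematicalPhysics.KineticTheory (T3 V3 hsDiameter localGibbsLaw blowUpPoint hsDiameter_pos
  succ_mul_hsDiameter_pow_three localGibbsLaw_eq localGibbsMeasure localGibbsMeasure_univ posPartition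
  posPartition_nonneg lintegral_localGibbsMeasure lintegral_posWeight_eq_one velMeasure zipConfig zipConfig_apply
  gaussMeasure lintegral_fintype_prod_eq_prod' canonicalPartition_eq_posPartition)
open Literature.MathematicalPhysics.KineticTheory.PointProcess (laplaceFunctional)
open Literature.Analysis.FluidPDE (HardSphereFlow Config windowSumReal particlesIn particlesIn_eq mem_particlesIn_iff)
open Literature.Analysis.FluidPDE.Torus (reprSym symCube measurable_reprSym map_reprSym_volume proj_reprSym
  closedBall_subset_symCube)
open Literature.Analysis.FunctionSpaces (PointConfig)
open Literature.Analysis.FunctionSpaces.Torus (proj unitCube continuous_proj measurableSet_unitCube mem_unitCube)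

/-! ## Assembly -/

/-- A tangent state of a family of probability laws is a probability law (test the Laplace functionals at `f = 0`:
`tangentLaplace … 0 = 1` and `laplaceFunctional μ 0 = μ(univ)`). -/
theorem isProbabilityMeasure_of_isTangentState {σ : ℝ} {φ : T3 → ℝ} (hφi : 0 < ∫ x, φ x) {N : ℕ → ℕ}
    {Q : ∀ k, Measure (Config (N k + 1) (Fin 3) T3)} (hQ : ∀ k, IsProbabilityMeasure (Q k)) {ι : ℕ → ℕ}
    {μ : Measure (PointConfig (V3 × V3))} (hμ : IsTangentState σ φ N Q ι μ) : IsProbabilityMeasure μ := by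
  have h1 : ∀ k, tangentLaplace σ φ (N (ι k)) (Q (ι k)) (fun _ => 0) = 1 := by
    intro k
    haveI := hQ (ι k)
    simp only [tangentLaplace, Finset.sum_const_zero, neg_zero, Real.exp_zero, integral_const, probReal_univ,
      smul_eq_mul, mul_one]
    exact inv_mul_cancel₀ hφi.ne'
  have h2 := hμ.2 (fun _ => 0) continuous_const HasCompactSupport.zero fun _ => le_rfl
  simp_rw [h1] at h2
  have h3 : laplaceFunctional μ (fun _ => (0 : ℝ)) = 1 := (tendsto_nhds_unique tendsto_const_nhds h2).symm
  have h4 : laplaceFunctional μ (fun _ => (0 : ℝ)) = μ.real univ := by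
    simp [laplaceFunctional]
  rw [h4, measureReal_def] at h3
  exact ⟨(ENNReal.toReal_eq_one_iff _).1 h3⟩

/-- **Bias continuity along tangent states** (registered stub `stub_tangentBias` of line `FirstLemma`, crux
stmt-AtomisticToContinuum-14135): along a tangent state `μ` of a tangent family, the normalised one-body bias
`(∫φ)⁻¹ σ³ (N+1)⁻¹ E_Q[Σᵢ φ(qᵢ) g((vᵢ − u₀)/√θ)]` converges to `E_μ[Σ_{p ∈ ω, p.1 ∈ [0,1)³} g((p.2 − u₀)/√θ)]`.
Registered stub `stub_tangentBiasOfFacts` (line `FirstLemma`): ASSEMBLY from the finite-`N` identities of files I–IV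
(`tendsto_oneBody_sub`, `velocityTail_of_isTangentFamily`, `abs_integral_oneBody_sub_cutoff_le`, `windowSum_approx`) and the
two `N = ∞` hypotheses `h₁` (one-body limit) and `h₂` (Campbell bound): truncate velocities at a radius `R` carrying
normalised mass `≤ δ₁` under all `Q_k` (entropy), replace `1_{[0,1)³}` by a continuous `ψ` equal to `1` off a shell
of volume `≤ 6δ₀`, pass to the limit in the `C_c` statistic `h = ψ ⊗ χ g̃`, and bound the four error terms by
`2 (∫φ)⁻¹σ³κ (6δ₀ + δ₁) + o(1)`. -/
theorem stub_tangentBiasOfFacts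
    (h₁ : ∀ (σ a θ : ℝ) (u₀ : V3) (κ : ℝ), 0 < σ →
      ∀ (φ : T3 → ℝ), Continuous φ → (∀ x, 0 ≤ φ x) → (∀ x, φ x ≤ 1) → 0 < ∫ x, φ x →
      ∀ (N : ℕ → ℕ)
        (Φ : ∀ k, HardSphereFlow (Literature.Analysis.FluidPDE.Torus.geometry (Fin 3)) (hsDiameter σ (N k)) (N k + 1))
        (Q : ∀ k, Measure (Config (N k + 1) (Fin 3) T3)),
        IsTangentFamily σ a θ u₀ κ N Φ Q →
        ∀ (ι : ℕ → ℕ) (μ : Measure (PointConfig (V3 × V3))), IsTangentState σ φ N Q ι μ →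
        ∀ (h : V3 × V3 → ℝ), Continuous h → HasCompactSupport h →
          Integrable (fun ω : PointConfig (V3 × V3) => ω.sumFn h) μ ∧
          Tendsto (fun k => (∫ x, φ x)⁻¹ * ∫ x : T3, φ x *
              ∫ z, (∑ i, h (blowUpPoint (hsDiameter σ (N (ι k))) x (z i))) ∂Q (ι k)) atTop
            (𝓝 (∫ ω, ω.sumFn h ∂μ)))
    (h₂ : ∀ (σ a θ : ℝ) (u₀ : V3) (κ : ℝ), 0 < σ →
      ∀ (φ : T3 → ℝ), Continuous φ → (∀ x, 0 ≤ φ x) → (∀ x, φ x ≤ 1) → 0 < ∫ x, φ x →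
      ∀ (N : ℕ → ℕ)
        (Φ : ∀ k, HardSphereFlow (Literature.Analysis.FluidPDE.Torus.geometry (Fin 3)) (hsDiameter σ (N k)) (N k + 1))
        (Q : ∀ k, Measure (Config (N k + 1) (Fin 3) T3)),
        IsTangentFamily σ a θ u₀ κ N Φ Q →
        ∀ (ι : ℕ → ℕ) (μ : Measure (PointConfig (V3 × V3))), IsTangentState σ φ N Q ι μ →
        (∀ (h : V3 × V3 → ℝ), Continuous h → HasCompactSupport h → (∀ p, 0 ≤ h p) →
          Integrable (fun ω : PointConfig (V3 × V3) => ω.sumFn h) μ ∧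
          Tendsto (fun k => (∫ x, φ x)⁻¹ * ∫ x : T3, φ x *
              ∫ z, (∑ i, h (blowUpPoint (hsDiameter σ (N (ι k))) x (z i))) ∂Q (ι k)) atTop
            (𝓝 (∫ ω, ω.sumFn h ∂μ))) →
        ∀ (R δ : ℝ), 0 ≤ δ →
          (∀ k, ((N (ι k) + 1 : ℕ) : ℝ)⁻¹ *
            ∫ z, (∑ i, ({v : V3 | R < ‖v‖}).indicator (fun _ => (1 : ℝ)) (z i).2) ∂Q (ι k) ≤ δ) →
        ∀ (S : Set V3), MeasurableSet S →
          ∫⁻ ω, ((ω.count (S ×ˢ {v : V3 | R < ‖v‖}) : ℕ∞) : ℝ≥0∞) ∂μ ≤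
            ENNReal.ofReal ((∫ x, φ x)⁻¹ * σ ^ 3 * δ) * volume S) :
    TangentBias := by
  intro σ a θ u₀ κ hσ ha hθ hκ φ hφ hφ0 hφ1 hφi g hg hgκ N Φ Q hfam ι μ hμ
  -- shorthand and basic facts
  have hφabs : ∀ x, |φ x| ≤ 1 := fun x => abs_le.2 ⟨by linarith [hφ0 x], hφ1 x⟩
  have hc0 : 0 < (∫ x, φ x)⁻¹ := inv_pos.2 hφi
  set c : ℝ := (∫ x, φ x)⁻¹ with hcdef
  set gt : V3 → ℝ := fun v => g ((Real.sqrt θ)⁻¹ • (v - u₀)) with hgtdef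
  have hgtc : Continuous gt := by
    have h1 : Continuous fun v : V3 => (Real.sqrt θ)⁻¹ • (v - u₀) :=
      (continuous_const_smul _).comp (continuous_id.sub continuous_const)
    exact hg.comp h1
  have hgtκ : ∀ v, |gt v| ≤ κ := fun v => hgκ _
  set G : V3 × V3 → ℝ := fun p => gt p.2 with hGdef
  have hGc : Continuous G := hgtc.comp continuous_snd
  have hGκ : ∀ p, |G p| ≤ κ := fun p => hgtκ _
  have hι : StrictMono ι := hμ.1
  have hNι : ∀ k, k ≤ N (ι k) := fun k => (hι.id_le k).trans (hfam.1 (ι k))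
  have hQprob : ∀ k, IsProbabilityMeasure (Q k) := hfam.2.1
  haveI : IsProbabilityMeasure μ := isProbabilityMeasure_of_isTangentState hφi hQprob hμ
  have hone : ∀ (h : V3 × V3 → ℝ), Continuous h → HasCompactSupport h → (∀ p, 0 ≤ h p) →
      Integrable (fun ω : PointConfig (V3 × V3) => ω.sumFn h) μ ∧
      Tendsto (fun k => (∫ x, φ x)⁻¹ * ∫ x : T3, φ x *
          ∫ z, (∑ i, h (blowUpPoint (hsDiameter σ (N (ι k))) x (z i))) ∂Q (ι k)) atTop
        (𝓝 (∫ ω, ω.sumFn h ∂μ)) := fun h hh hhs _ =>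
    h₁ σ a θ u₀ κ hσ φ hφ hφ0 hφ1 hφi N Φ Q hfam ι μ hμ h hh hhs
  set L : ℝ := ∫ ω, windowSumReal ω (unitCube (Fin 3)) G ∂μ with hLdef
  set b : ℕ → ℝ := fun k => c * σ ^ 3 * ((N (ι k) + 1 : ℕ) : ℝ)⁻¹ *
      ∫ z, (∑ i, φ (z i).1 * gt (z i).2) ∂Q (ι k) with hbdef
  change Tendsto b atTop (𝓝 L)
  -- (0) intensity of the tangent state: `E_μ[#(S × ℝ³)] ≤ c σ³ vol S`
  have huniv : {v : V3 | (-1 : ℝ) < ‖v‖} = univ :=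
    eq_univ_of_forall fun v => lt_of_lt_of_le neg_one_lt_zero (norm_nonneg v)
  have htail1 : ∀ k, ((N (ι k) + 1 : ℕ) : ℝ)⁻¹ *
      ∫ z, (∑ i, ({v : V3 | (-1 : ℝ) < ‖v‖}).indicator (fun _ => (1 : ℝ)) (z i).2) ∂Q (ι k) ≤ 1 := by
    intro k
    haveI := hQprob (ι k)
    have hsum : ∀ z : Config (N (ι k) + 1) (Fin 3) T3,
        (∑ i, ({v : V3 | (-1 : ℝ) < ‖v‖}).indicator (fun _ => (1 : ℝ)) (z i).2) = ((N (ι k) + 1 : ℕ) : ℝ) := by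
      intro z
      rw [huniv]
      simp
    simp_rw [hsum]
    rw [integral_const, probReal_univ, one_smul, inv_mul_cancel₀ (by positivity)]
  have hintensity : ∀ S : Set V3, MeasurableSet S →
      ∫⁻ ω, ((ω.count (S ×ˢ (univ : Set V3)) : ℕ∞) : ℝ≥0∞) ∂μ ≤ ENNReal.ofReal (c * σ ^ 3) * volume S := by
    intro S hS
    have h := h₂ σ a θ u₀ κ hσ φ hφ hφ0 hφ1 hφi N Φ Q hfam ι μ hμ hone (-1) 1 zero_le_one htail1 S hS
    rwa [huniv, mul_one] at h
  -- metric form of the claim, and the error budget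
  rw [Metric.tendsto_atTop]
  intro τ hτ
  set A : ℝ := c * σ ^ 3 * κ + 1 with hAdef
  have hA0 : 0 < A := by positivity
  have hAle : c * σ ^ 3 * κ ≤ A := by linarith
  set δ₁ : ℝ := τ / (8 * A) with hδ₁def
  have hδ₁ : 0 < δ₁ := by positivity
  set δ₀ : ℝ := min (1 / 4) (τ / (48 * A)) with hδ₀def
  have hδ₀ : 0 < δ₀ := lt_min (by norm_num) (by positivity)
  have hδ₀' : δ₀ ≤ 1 / 2 := (min_le_left _ _).trans (by norm_num)
  have h6δ₀ : 6 * δ₀ ≤ τ / (8 * A) := by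
    have h := min_le_right (1 / 4 : ℝ) (τ / (48 * A))
    calc 6 * δ₀ ≤ 6 * (τ / (48 * A)) := by gcongr
      _ = τ / (8 * A) := by field_simp; ring
  -- (F2) velocity tail radius
  obtain ⟨R, -, htail⟩ := velocityTail_of_isTangentFamily ha hθ hκ hfam hδ₁
  have htailι : ∀ k, ((N (ι k) + 1 : ℕ) : ℝ)⁻¹ *
      ∫ z, (∑ i, ({v : V3 | R < ‖v‖}).indicator (fun _ => (1 : ℝ)) (z i).2) ∂Q (ι k) ≤ δ₁ := fun k => htail (ι k)
  -- cutoffs in position and velocity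
  obtain ⟨ψ, hψc, hψcs, hψ0, hψ1, hψsupp, hψinner, hψlow, hψup⟩ := exists_position_cutoff hδ₀ hδ₀'
  obtain ⟨χ, hχc, hχcs, hχ0, hχ1, hχR⟩ := exists_velocity_cutoff R
  obtain ⟨hSm, hSvol⟩ := volume_real_shell_le hδ₀ hδ₀'
  set S : Set V3 := unitCube (Fin 3) \ {y : V3 | ∀ i, y i ∈ Icc δ₀ (1 - δ₀)} with hSdef
  have hSc : S ⊆ unitCube (Fin 3) := fun _ hy => hy.1
  have hψS : ∀ y ∈ unitCube (Fin 3), y ∉ S → ψ y = 1 := fun y hy hyS =>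
    hψinner y (by by_contra h; exact hyS ⟨hy, h⟩)
  have ha0 : 0 ≤ ∫ y, ψ y := (pow_nonneg (by linarith) 3).trans hψlow
  have h1a : 1 - ∫ y, ψ y ≤ 6 * δ₀ := by
    have hexp : (1 - 2 * δ₀) ^ 3 = 1 - 6 * δ₀ + (2 * δ₀) ^ 2 * (3 - 2 * δ₀) := by ring
    have hnn : 0 ≤ (2 * δ₀) ^ 2 * (3 - 2 * δ₀) := mul_nonneg (sq_nonneg _) (by linarith)
    linarith
  -- the test function `h = ψ ⊗ (χ g̃)`
  set η : V3 → ℝ := fun v => χ v * gt v with hηdef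
  have hηc : Continuous η := hχc.mul hgtc
  have hηκ : ∀ v, |η v| ≤ κ := fun v => by
    show |χ v * gt v| ≤ κ
    rw [abs_mul, abs_of_nonneg (hχ0 v)]
    exact (mul_le_mul (hχ1 v) (hgtκ v) (abs_nonneg _) zero_le_one).trans_eq (one_mul κ)
  set h : V3 × V3 → ℝ := fun p => ψ p.1 * (χ p.2 * G p) with hhdef
  have hhc : Continuous h := (hψc.comp continuous_fst).mul ((hχc.comp continuous_snd).mul hGc)
  have hhcs : HasCompactSupport h := by
    refine HasCompactSupport.intro (hψcs.prod hχcs) fun p hp => ?_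
    rw [Set.mem_prod, not_and_or] at hp
    show ψ p.1 * (χ p.2 * G p) = 0
    rcases hp with hp | hp
    · rw [image_eq_zero_of_notMem_tsupport hp, zero_mul]
    · rw [image_eq_zero_of_notMem_tsupport hp, zero_mul, mul_zero]
  -- (F1) the one-body limit for `h`
  obtain ⟨-, hAk⟩ := h₁ σ a θ u₀ κ hσ φ hφ hφ0 hφ1 hφi N Φ Q hfam ι μ hμ h hhc hhcs
  set Lh : ℝ := ∫ ω, ω.sumFn h ∂μ with hLhdef
  -- the finite-`N` sequences
  set B : ℕ → ℝ := fun k => ∫ x : T3, φ x *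
      ∫ z, (∑ i, ψ (blowUpPoint (hsDiameter σ (N (ι k))) x (z i)).1 * η (z i).2) ∂Q (ι k) with hBdef
  set I2 : ℕ → ℝ := fun k => ∫ z, (∑ i, φ (z i).1 * η (z i).2) ∂Q (ι k) with hI2def
  have hAB : ∀ k, (c * ∫ x : T3, φ x *
      ∫ z, (∑ i, h (blowUpPoint (hsDiameter σ (N (ι k))) x (z i))) ∂Q (ι k)) = c * B k := fun k => rfl
  have hAk' : Tendsto (fun k => c * B k) atTop (𝓝 Lh) := by
    refine hAk.congr' (Eventually.of_forall fun k => hAB k)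
  -- (P1) along the subsequence
  have hP1 : Tendsto (fun k => B k - hsDiameter σ (N (ι k)) ^ 3 * (∫ y, ψ y) * I2 k) atTop (𝓝 0) :=
    tendsto_oneBody_sub hσ hφ hφabs hNι (fun k => Q (ι k)) (fun k => hQprob (ι k)) hψc hψcs hηc hηκ
  -- (F4, F3) the `μ`-side errors
  have hcube_fin : ∫⁻ ω, ((ω.count (unitCube (Fin 3) ×ˢ (univ : Set V3)) : ℕ∞) : ℝ≥0∞) ∂μ ≠ ⊤ := by
    refine ne_top_of_le_ne_top ?_ (hintensity _ measurableSet_unitCube)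
    rw [volume_unitCube_three, mul_one]
    exact ENNReal.ofReal_ne_top
  obtain ⟨-, hW⟩ := windowSum_approx μ hcube_fin hGc hGκ hψc hψ0 hψ1 hψsupp hSm hSc hψS hχc hχ0 hχ1 hχR
  have hshell : (∫⁻ ω, ((ω.count (S ×ˢ (univ : Set V3)) : ℕ∞) : ℝ≥0∞) ∂μ).toReal ≤ c * σ ^ 3 * (6 * δ₀) := by
    have h1 := hintensity S hSm
    have h2 : volume S ≠ ⊤ :=
      ne_top_of_le_ne_top (by rw [volume_unitCube_three]; exact ENNReal.one_ne_top) (measure_mono hSc)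
    calc (∫⁻ ω, ((ω.count (S ×ˢ (univ : Set V3)) : ℕ∞) : ℝ≥0∞) ∂μ).toReal
        ≤ (ENNReal.ofReal (c * σ ^ 3) * volume S).toReal :=
          ENNReal.toReal_mono (ENNReal.mul_ne_top ENNReal.ofReal_ne_top h2) h1
      _ = c * σ ^ 3 * volume.real S := by
          rw [ENNReal.toReal_mul, ENNReal.toReal_ofReal (by positivity), measureReal_def]
      _ ≤ c * σ ^ 3 * (6 * δ₀) := by gcongr
  have htailμ : (∫⁻ ω, ((ω.count (unitCube (Fin 3) ×ˢ {v : V3 | R < ‖v‖}) : ℕ∞) : ℝ≥0∞) ∂μ).toReal ≤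
      c * σ ^ 3 * δ₁ := by
    have h1 := h₂ σ a θ u₀ κ hσ φ hφ hφ0 hφ1 hφi N Φ Q hfam ι μ hμ hone R δ₁ hδ₁.le htailι _ measurableSet_unitCube
    rw [volume_unitCube_three, mul_one] at h1
    calc (∫⁻ ω, ((ω.count (unitCube (Fin 3) ×ˢ {v : V3 | R < ‖v‖}) : ℕ∞) : ℝ≥0∞) ∂μ).toReal
        ≤ (ENNReal.ofReal (c * σ ^ 3 * δ₁)).toReal := ENNReal.toReal_mono ENNReal.ofReal_ne_top h1
      _ = c * σ ^ 3 * δ₁ := ENNReal.toReal_ofReal (by positivity)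
  have hμside : |L - Lh| ≤ κ * (c * σ ^ 3 * (6 * δ₀) + c * σ ^ 3 * δ₁) :=
    hW.trans (mul_le_mul_of_nonneg_left (add_le_add hshell htailμ) hκ.le)
  -- (finite `N`) the velocity cutoff and the mass defect of `ψ`
  have hfinN : ∀ k, |b k - c * (hsDiameter σ (N (ι k)) ^ 3 * (∫ y, ψ y) * I2 k)| ≤
      c * σ ^ 3 * κ * (6 * δ₀ + δ₁) := by
    intro k
    haveI := hQprob (ι k)
    have he : 0 < hsDiameter σ (N (ι k)) := hsDiameter_pos hσ _
    have hne : σ ^ 3 * ((N (ι k) + 1 : ℕ) : ℝ)⁻¹ = hsDiameter σ (N (ι k)) ^ 3 := by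
      have h3 := succ_mul_hsDiameter_pow_three σ (N (ι k))
      have hn : (0 : ℝ) < ((N (ι k) + 1 : ℕ) : ℝ) := by positivity
      field_simp
      linarith
    have hcut := abs_integral_oneBody_sub_cutoff_le (Q (ι k)) hφ hφ0 hφ1 hgtc hgtκ hχc hχ0 hχ1 hχR ha0 hψup
    set T : ℝ := ∫ z, (∑ i, ({v : V3 | R < ‖v‖}).indicator (fun _ => (1 : ℝ)) (z i).2) ∂Q (ι k) with hTdef
    have hT0 : 0 ≤ T := integral_nonneg fun z => Finset.sum_nonneg fun i _ =>
      Set.indicator_nonneg (fun _ _ => zero_le_one) _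
    have hTδ : hsDiameter σ (N (ι k)) ^ 3 * T ≤ σ ^ 3 * δ₁ := by
      rw [← hne, mul_assoc]
      exact mul_le_mul_of_nonneg_left (htailι k) (by positivity)
    have hdiff : b k - c * (hsDiameter σ (N (ι k)) ^ 3 * (∫ y, ψ y) * I2 k) =
        c * hsDiameter σ (N (ι k)) ^ 3 * ((∫ z, (∑ i, φ (z i).1 * gt (z i).2) ∂Q (ι k)) -
          (∫ y, ψ y) * I2 k) := by
      show c * σ ^ 3 * ((N (ι k) + 1 : ℕ) : ℝ)⁻¹ * (∫ z, (∑ i, φ (z i).1 * gt (z i).2) ∂Q (ι k)) -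
          c * (hsDiameter σ (N (ι k)) ^ 3 * (∫ y, ψ y) * I2 k) = _
      rw [← hne]
      ring
    rw [hdiff, abs_mul, abs_of_pos (mul_pos hc0 (pow_pos he 3))]
    calc c * hsDiameter σ (N (ι k)) ^ 3 * |(∫ z, (∑ i, φ (z i).1 * gt (z i).2) ∂Q (ι k)) - (∫ y, ψ y) * I2 k|
        ≤ c * hsDiameter σ (N (ι k)) ^ 3 * (κ * (((N (ι k) + 1 : ℕ) : ℝ) * (1 - ∫ y, ψ y) + T)) :=
          mul_le_mul_of_nonneg_left hcut (by positivity)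
      _ = c * κ * ((((N (ι k) + 1 : ℕ) : ℝ) * hsDiameter σ (N (ι k)) ^ 3) * (1 - ∫ y, ψ y) +
            hsDiameter σ (N (ι k)) ^ 3 * T) := by ring
      _ = c * κ * (σ ^ 3 * (1 - ∫ y, ψ y) + hsDiameter σ (N (ι k)) ^ 3 * T) := by
          rw [succ_mul_hsDiameter_pow_three]
      _ ≤ c * κ * (σ ^ 3 * (6 * δ₀) + σ ^ 3 * δ₁) := by gcongr
      _ = c * σ ^ 3 * κ * (6 * δ₀ + δ₁) := by ring
  -- (limits) the two vanishing terms
  obtain ⟨K₁, hK₁⟩ := (Metric.tendsto_atTop.1 hP1) (τ / (4 * c)) (by positivity)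
  obtain ⟨K₂, hK₂⟩ := (Metric.tendsto_atTop.1 hAk') (τ / 4) (by positivity)
  refine ⟨max K₁ K₂, fun k hk => ?_⟩
  have h1 : c * |B k - hsDiameter σ (N (ι k)) ^ 3 * (∫ y, ψ y) * I2 k| < τ / 4 := by
    have h := hK₁ k ((le_max_left _ _).trans hk)
    rw [dist_zero_right, Real.norm_eq_abs] at h
    calc c * |B k - hsDiameter σ (N (ι k)) ^ 3 * (∫ y, ψ y) * I2 k| < c * (τ / (4 * c)) := by gcongr
      _ = τ / 4 := by field_simp
  have h2 : |c * B k - Lh| < τ / 4 := by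
    have h := hK₂ k ((le_max_right _ _).trans hk)
    rwa [Real.dist_eq] at h
  have hbudget : 2 * (c * σ ^ 3 * κ * (6 * δ₀ + δ₁)) ≤ τ / 2 := by
    calc 2 * (c * σ ^ 3 * κ * (6 * δ₀ + δ₁)) ≤ 2 * (A * (τ / (8 * A) + τ / (8 * A))) := by gcongr
      _ = τ / 2 := by field_simp; ring
  rw [Real.dist_eq]
  calc |b k - L| ≤ |b k - c * (hsDiameter σ (N (ι k)) ^ 3 * (∫ y, ψ y) * I2 k)| +
        |c * (hsDiameter σ (N (ι k)) ^ 3 * (∫ y, ψ y) * I2 k) - c * B k| + |c * B k - Lh| + |Lh - L| := by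
        have := abs_sub_le (b k) (c * (hsDiameter σ (N (ι k)) ^ 3 * (∫ y, ψ y) * I2 k)) L
        have := abs_sub_le (c * (hsDiameter σ (N (ι k)) ^ 3 * (∫ y, ψ y) * I2 k)) (c * B k) L
        have := abs_sub_le (c * B k) Lh L
        linarith
    _ < c * σ ^ 3 * κ * (6 * δ₀ + δ₁) + τ / 4 + τ / 4 + κ * (c * σ ^ 3 * (6 * δ₀) + c * σ ^ 3 * δ₁) := by
        have h1' : |c * (hsDiameter σ (N (ι k)) ^ 3 * (∫ y, ψ y) * I2 k) - c * B k| < τ / 4 := by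
          rw [← mul_sub, abs_mul, abs_of_pos hc0, ← abs_neg, neg_sub]
          exact h1
        have h4 : |Lh - L| ≤ κ * (c * σ ^ 3 * (6 * δ₀) + c * σ ^ 3 * δ₁) := by rw [abs_sub_comm]; exact hμside
        linarith [hfinN k]
    _ = 2 * (c * σ ^ 3 * κ * (6 * δ₀ + δ₁)) + τ / 2 := by ring
    _ ≤ τ / 2 + τ / 2 := by linarith
    _ = τ := by ring


end Summit.AtomisticToContinuum.HydrodynamicLimit.Theorems.KiferCompactification
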